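import Summits.HubbardSuperconductivity.HubbardSuperconductivity.Theorems.MesoscopicPairOrder.Negative.NoSaturationWindow
import Mathlib.Analysis.SpecialFunctions.Trigonometric.Basic

/-!
# Crux `MesoscopicPairOrder` (item `stmt-HubbardSuperconductivity-7331`): explicit boxes where the
# saturated-ferromagnet exclusion is void

Negative-side support (lead c7, line `pointwise_split`), third file: the single-flip criterion of
`NoSaturationWindow.not_frequently_saturated` (`0 ≤ U`, `0 < δ < 2θ²`, `0 < θ < 1/2`,
`U (1 - δ) < 4 + 4cos²(πθ)`) evaluated at exact angles.

* `not_frequently_saturated_of_lt_four` — `θ ↗ 1/2`: at EVERY `δ ∈ (0, 1/2)`, `0 ≤ U`, `U(1 - δ) < 4`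
  suffices (so `U ≤ 4` everywhere off half filling, `U < 4.8` at `δ = 1/6`).
* `cos_sq_pi_mul_…` — `cos²(πθ)` at `θ = 1/4, 3/10, 3/8, 2/5`: `1/2`, `(5-√5)/8`, `(2-√2)/4`, `(3-√5)/8`
  (`θ = 1/3`: `1/4`, Mathlib's `cos_pi_div_three`, inlined) (thresholds `4 + 4cos² = 6, (13-√5)/2 ≈ 5.38, 5, 6-√2 ≈ 4.59, (11-√5)/2 ≈ 4.38` for
  `U(1-δ)`, valid for `δ < 1/8, 9/50, 2/9, 9/32, 8/25`).
* `not_frequently_saturated_window` — the box `0 ≤ U ≤ 57/10`, `δ ∈ [1/10, 3/10]` (five angle cases);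
  `not_frequently_saturated_window_six_low/high` — `0 ≤ U ≤ 6` on `δ ∈ [1/10, 2/9)` and on
  `δ ∈ [6/25, 3/10]`.

So on `[0, 57/10] × [1/10, 3/10] ∪ [0, 6] × ([1/10, 2/9) ∪ [6/25, 3/10])` — containing the route's primary
window point `(4, 1/6)` and all of its target box `[4, 6] × [3/20, 1/4]` except the sliver
`(57/10, 6] × [2/9, 6/25)` — the hypothesis of `Negative/SaturatedExclusion.pointwise_false_of_saturated`
is false: a witness `(U, δ)` of the crux there is automatically clear of the Nagaoka hazard. (The true
single-flip threshold with exact level counting is `U(1-δ) < 4 + ε_F(1-δ) ≈ 5.9` at `δ = 1/5`, i.e.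
`U ≲ 7.3`; the diamond count used here gives `≈ 6.5`.) Nothing here proves or refutes the crux.
Sources: H. Tasaki, Prog. Theor. Phys. 99 (1998) 489, Thm 3.2; folklore trigonometry. No definition,
no named fact.
-/

noncomputable section

-- the summit namespace repeats the problem name by design (D-0017)
set_option linter.dupNamespace false

namespace Summit.HubbardSuperconductivity.HubbardSuperconductivity.Theorems.MesoscopicPairOrder.Negative

open Matrix Finset Filter
open Literature.Probability.LatticeModels Literature.MathematicalPhysics.QuantumLattice
open scoped ComplexOrder ComplexConjugate

/-! ### A lower bound on `cos²(πθ)` suffices -/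

/-- The single-flip criterion with any lower bound `c ≤ cos²(πθ)`. [folklore] -/
theorem not_frequently_saturated_of_cos_sq_ge {U δ θ c : ℝ} (hU0 : 0 ≤ U) (hδ : 0 < δ)
    (hδθ : δ < 2 * θ ^ 2) (hθ0 : 0 < θ) (hθ : θ < 1 / 2) (hc : c ≤ Real.cos (Real.pi * θ) ^ 2)
    (hU : U * (1 - δ) < 4 + 4 * c) :
    ¬ ∃ᶠ L : ℕ in atTop, Even L ∧ ∃ ψ : Fock (Orb (FermionTorus 2 L)),
      IsGroundStateInSector (hubbardTorus 2 L 1 U) (2 * ⌊(1 - δ) * (L : ℝ) ^ 2 / 2⌋₊) 0 ψ ∧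
        spinSq *ᵥ ψ = (((⌊(1 - δ) * (L : ℝ) ^ 2 / 2⌋₊ : ℝ) *
          ((⌊(1 - δ) * (L : ℝ) ^ 2 / 2⌋₊ : ℝ) + 1) : ℝ) : ℂ) • ψ :=
  not_frequently_saturated hU0 hδ hδθ hθ0 hθ (by linarith)

/-- **`U(1-δ) < 4` excludes saturated ferromagnetism at EVERY doping `δ ∈ (0, 1/2)`** (angle
`θ = (√(δ/2) + 1/2)/2 ↗ 1/2`, `cos² ≥ 0`): in particular `0 ≤ U ≤ 4` is clear of the Nagaoka hazard
everywhere off half filling in the crux's range. [folklore] -/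
theorem not_frequently_saturated_of_lt_four {U δ : ℝ} (hU0 : 0 ≤ U) (hδ : δ ∈ Set.Ioo (0 : ℝ) (1 / 2))
    (hU : U * (1 - δ) < 4) :
    ¬ ∃ᶠ L : ℕ in atTop, Even L ∧ ∃ ψ : Fock (Orb (FermionTorus 2 L)),
      IsGroundStateInSector (hubbardTorus 2 L 1 U) (2 * ⌊(1 - δ) * (L : ℝ) ^ 2 / 2⌋₊) 0 ψ ∧
        spinSq *ᵥ ψ = (((⌊(1 - δ) * (L : ℝ) ^ 2 / 2⌋₊ : ℝ) *
          ((⌊(1 - δ) * (L : ℝ) ^ 2 / 2⌋₊ : ℝ) + 1) : ℝ) : ℂ) • ψ := by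
  have hs0 : 0 ≤ Real.sqrt (δ / 2) := Real.sqrt_nonneg _
  have hs : Real.sqrt (δ / 2) < 1 / 2 := by
    rw [Real.sqrt_lt' (by norm_num)]
    linarith [hδ.2]
  have hsq : Real.sqrt (δ / 2) ^ 2 = δ / 2 := Real.sq_sqrt (by linarith [hδ.1])
  refine not_frequently_saturated_of_cos_sq_ge (θ := (Real.sqrt (δ / 2) + 1 / 2) / 2) (c := 0) hU0 hδ.1
    ?_ (by linarith) (by linarith) (sq_nonneg _) (by linarith)
  nlinarith

/-! ### `cos²(πθ)` at the five angles -/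

/-- `cos²(π/4) = 1/2`. [folklore] -/
theorem cos_sq_pi_mul_one_div_four : Real.cos (Real.pi * (1 / 4)) ^ 2 = 1 / 2 := by
  rw [show Real.pi * (1 / 4) = Real.pi / 4 by ring, Real.cos_pi_div_four, div_pow,
    Real.sq_sqrt (by norm_num)]
  norm_num

/-- `cos²(3π/8) = (2 - √2)/4` (`cos² x = (1 + cos 2x)/2`, `cos(3π/4) = -√2/2`). [folklore] -/
theorem cos_sq_pi_mul_three_div_eight : Real.cos (Real.pi * (3 / 8)) ^ 2 = (2 - Real.sqrt 2) / 4 := by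
  rw [Real.cos_sq, show 2 * (Real.pi * (3 / 8)) = Real.pi - Real.pi / 4 by ring, Real.cos_pi_sub,
    Real.cos_pi_div_four]
  ring

/-- `cos²(2π/5) = (3 - √5)/8` (`cos(2x) = 2cos² x - 1`, `cos(π/5) = (1 + √5)/4`). [folklore] -/
theorem cos_sq_pi_mul_two_div_five : Real.cos (Real.pi * (2 / 5)) ^ 2 = (3 - Real.sqrt 5) / 8 := by
  rw [show Real.pi * (2 / 5) = 2 * (Real.pi / 5) by ring, Real.cos_two_mul, Real.cos_pi_div_five]
  have h5 : Real.sqrt 5 ^ 2 = 5 := Real.sq_sqrt (by norm_num)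
  nlinarith [h5]

/-- `cos²(3π/10) = (5 - √5)/8` (`cos(3π/10) = sin(π/5)`, `sin² = 1 - cos²`, `cos(π/5) = (1 + √5)/4`).
[folklore] -/
theorem cos_sq_pi_mul_three_div_ten : Real.cos (Real.pi * (3 / 10)) ^ 2 = (5 - Real.sqrt 5) / 8 := by
  rw [show Real.pi * (3 / 10) = Real.pi / 2 - Real.pi / 5 by ring, Real.cos_pi_div_two_sub,
    Real.sin_sq, Real.cos_pi_div_five]
  have h5 : Real.sqrt 5 ^ 2 = 5 := Real.sq_sqrt (by norm_num)
  nlinarith [h5]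

/-- `√5 < 56/25 = 2.24`. [folklore] -/
theorem sqrt_five_lt : Real.sqrt 5 < 56 / 25 := by
  rw [Real.sqrt_lt' (by norm_num)]; norm_num

/-- `√2 < 71/50 = 1.42`. [folklore] -/
theorem sqrt_two_lt : Real.sqrt 2 < 71 / 50 := by
  rw [Real.sqrt_lt' (by norm_num)]; norm_num

/-! ### The boxes -/

/-- **No saturated ferromagnetism on `[0, 57/10] × [1/10, 3/10]`** (along even sides, eventually; in the
`∃ᶠ`-negated form consumed by `pointwise_false_of_saturated`). Five angle cases:
`δ < 1/8` (`θ = 1/4`), `< 9/50` (`3/10`), `< 2/9` (`1/3`), `< 9/32` (`3/8`), `≤ 3/10` (`2/5`). [folklore] -/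
theorem not_frequently_saturated_window {U δ : ℝ} (hU0 : 0 ≤ U) (hU : U ≤ 57 / 10)
    (hδ : δ ∈ Set.Icc (1 / 10 : ℝ) (3 / 10)) :
    ¬ ∃ᶠ L : ℕ in atTop, Even L ∧ ∃ ψ : Fock (Orb (FermionTorus 2 L)),
      IsGroundStateInSector (hubbardTorus 2 L 1 U) (2 * ⌊(1 - δ) * (L : ℝ) ^ 2 / 2⌋₊) 0 ψ ∧
        spinSq *ᵥ ψ = (((⌊(1 - δ) * (L : ℝ) ^ 2 / 2⌋₊ : ℝ) *
          ((⌊(1 - δ) * (L : ℝ) ^ 2 / 2⌋₊ : ℝ) + 1) : ℝ) : ℂ) • ψ := by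
  obtain ⟨hδ1, hδ2⟩ := hδ
  have hδ0 : 0 < δ := by linarith
  have h1δ : 0 ≤ 1 - δ := by linarith
  have hprod : U * (1 - δ) ≤ 57 / 10 * (1 - δ) := mul_le_mul_of_nonneg_right hU h1δ
  have hthird : (1 / 4 : ℝ) ≤ Real.cos (Real.pi * (1 / 3)) ^ 2 := by
    rw [show Real.pi * (1 / 3) = Real.pi / 3 by ring, Real.cos_pi_div_three]; norm_num
  have h5 := sqrt_five_lt
  have h2 := sqrt_two_lt
  rcases lt_or_ge δ (1 / 8) with hA | hA
  · exact not_frequently_saturated_of_cos_sq_ge (θ := 1 / 4) (c := 1 / 2) hU0 hδ0 (by nlinarith)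
      (by norm_num) (by norm_num) cos_sq_pi_mul_one_div_four.ge (by nlinarith)
  rcases lt_or_ge δ (9 / 50) with hB | hB
  · exact not_frequently_saturated_of_cos_sq_ge (θ := 3 / 10) (c := (5 - Real.sqrt 5) / 8) hU0 hδ0
      (by nlinarith) (by norm_num) (by norm_num) cos_sq_pi_mul_three_div_ten.ge (by nlinarith)
  rcases lt_or_ge δ (2 / 9) with hC | hC
  · exact not_frequently_saturated_of_cos_sq_ge (θ := 1 / 3) (c := 1 / 4) hU0 hδ0 (by nlinarith)
      (by norm_num) (by norm_num) hthird (by nlinarith)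
  rcases lt_or_ge δ (9 / 32) with hD | hD
  · exact not_frequently_saturated_of_cos_sq_ge (θ := 3 / 8) (c := (2 - Real.sqrt 2) / 4) hU0 hδ0
      (by nlinarith) (by norm_num) (by norm_num) cos_sq_pi_mul_three_div_eight.ge (by nlinarith)
  · exact not_frequently_saturated_of_cos_sq_ge (θ := 2 / 5) (c := (3 - Real.sqrt 5) / 8) hU0 hδ0
      (by nlinarith) (by norm_num) (by norm_num) cos_sq_pi_mul_two_div_five.ge (by nlinarith)

/-- **No saturated ferromagnetism on `[0, 6] × [1/10, 2/9)`** (angles `1/4`, `3/10`, `1/3`). [folklore] -/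
theorem not_frequently_saturated_window_six_low {U δ : ℝ} (hU0 : 0 ≤ U) (hU : U ≤ 6)
    (hδ : δ ∈ Set.Ico (1 / 10 : ℝ) (2 / 9)) :
    ¬ ∃ᶠ L : ℕ in atTop, Even L ∧ ∃ ψ : Fock (Orb (FermionTorus 2 L)),
      IsGroundStateInSector (hubbardTorus 2 L 1 U) (2 * ⌊(1 - δ) * (L : ℝ) ^ 2 / 2⌋₊) 0 ψ ∧
        spinSq *ᵥ ψ = (((⌊(1 - δ) * (L : ℝ) ^ 2 / 2⌋₊ : ℝ) *
          ((⌊(1 - δ) * (L : ℝ) ^ 2 / 2⌋₊ : ℝ) + 1) : ℝ) : ℂ) • ψ := by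
  obtain ⟨hδ1, hδ2⟩ := hδ
  have hδ0 : 0 < δ := by linarith
  have h1δ : 0 ≤ 1 - δ := by linarith
  have hprod : U * (1 - δ) ≤ 6 * (1 - δ) := mul_le_mul_of_nonneg_right hU h1δ
  have hthird : (1 / 4 : ℝ) ≤ Real.cos (Real.pi * (1 / 3)) ^ 2 := by
    rw [show Real.pi * (1 / 3) = Real.pi / 3 by ring, Real.cos_pi_div_three]; norm_num
  have h5 := sqrt_five_lt
  rcases lt_or_ge δ (1 / 8) with hA | hA
  · exact not_frequently_saturated_of_cos_sq_ge (θ := 1 / 4) (c := 1 / 2) hU0 hδ0 (by nlinarith)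
      (by norm_num) (by norm_num) cos_sq_pi_mul_one_div_four.ge (by nlinarith)
  rcases lt_or_ge δ (9 / 50) with hB | hB
  · exact not_frequently_saturated_of_cos_sq_ge (θ := 3 / 10) (c := (5 - Real.sqrt 5) / 8) hU0 hδ0
      (by nlinarith) (by norm_num) (by norm_num) cos_sq_pi_mul_three_div_ten.ge (by nlinarith)
  · exact not_frequently_saturated_of_cos_sq_ge (θ := 1 / 3) (c := 1 / 4) hU0 hδ0 (by nlinarith)
      (by norm_num) (by norm_num) hthird (by nlinarith)

/-- **No saturated ferromagnetism on `[0, 6] × [6/25, 3/10]`** (angles `3/8`, `2/5`). [folklore] -/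
theorem not_frequently_saturated_window_six_high {U δ : ℝ} (hU0 : 0 ≤ U) (hU : U ≤ 6)
    (hδ : δ ∈ Set.Icc (6 / 25 : ℝ) (3 / 10)) :
    ¬ ∃ᶠ L : ℕ in atTop, Even L ∧ ∃ ψ : Fock (Orb (FermionTorus 2 L)),
      IsGroundStateInSector (hubbardTorus 2 L 1 U) (2 * ⌊(1 - δ) * (L : ℝ) ^ 2 / 2⌋₊) 0 ψ ∧
        spinSq *ᵥ ψ = (((⌊(1 - δ) * (L : ℝ) ^ 2 / 2⌋₊ : ℝ) *
          ((⌊(1 - δ) * (L : ℝ) ^ 2 / 2⌋₊ : ℝ) + 1) : ℝ) : ℂ) • ψ := by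
  obtain ⟨hδ1, hδ2⟩ := hδ
  have hδ0 : 0 < δ := by linarith
  have h1δ : 0 ≤ 1 - δ := by linarith
  have hprod : U * (1 - δ) ≤ 6 * (1 - δ) := mul_le_mul_of_nonneg_right hU h1δ
  have h5 := sqrt_five_lt
  have h2 := sqrt_two_lt
  rcases lt_or_ge δ (9 / 32) with hD | hD
  · exact not_frequently_saturated_of_cos_sq_ge (θ := 3 / 8) (c := (2 - Real.sqrt 2) / 4) hU0 hδ0
      (by nlinarith) (by norm_num) (by norm_num) cos_sq_pi_mul_three_div_eight.ge (by nlinarith)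
  · exact not_frequently_saturated_of_cos_sq_ge (θ := 2 / 5) (c := (3 - Real.sqrt 5) / 8) hU0 hδ0
      (by nlinarith) (by norm_num) (by norm_num) cos_sq_pi_mul_two_div_five.ge (by nlinarith)

end Summit.HubbardSuperconductivity.HubbardSuperconductivity.Theorems.MesoscopicPairOrder.Negative
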